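import Summits.Ventures.CertifiedQuantumChemistry.Rows.DominantPencilPSD
import Summits.Ventures.CertifiedQuantumChemistry.Rows.SqrtTwoFactorPSD
import HarnessLib

/-!
# Ventures/CertifiedQuantumChemistry — Rows/PencilBlockCertificate.lean: ONE BLOCK of a polynomial-lift feasibility
# certificate — from tables over `ℚ(√2)` and kernel-decidable identities to "`X(η², δ) ⪰ 0` for every `δ ∈ (0, 1]` and
# every `0 ≤ η ≤ min(1, δμ/Σρ)`"

HONEST FRAMING (verbatim): certified bounds for a stated model Hamiltonian in a stated basis; not a
claim about the real molecule beyond that model. Nothing in this file asserts a value, a row or a claim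
node; it types a CERTIFICATE FORMAT (data over `ℚ × ℚ`, conclusions over `ℝ`).

Seat rdm-B (gen 41), zero compute. The analytic core of a kernel-grade version of the cell's exact lifts (STRUCTURE
§2.2.14: `liminf_U ĉ_DQG(4;U) ≥ √2 − 1` at words + exact-certificate grade). A symmetry block of the lifted pair is a
matrix polynomial `X(ε, δ) = Σ_{j ≤ 2, k ≤ 1} ε^j δ^k X_{jk}` (`ε = t/U`; entries in `ℚ(√2)`, here PAIRS, `Rows/SqrtTwoFactorPSD`).
With a basis `T₀` adapted to the kernel of `X₀₀` and EXPONENTS `a_i ∈ {0, 1, 2}` (plain / first-order / second-order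
directions) the congruence `T(η) = T₀·diag(η^{−a})` turns `X(η², δ)` into a polynomial pencil
`P(η, δ) = Σ_{m ≤ 4} η^m (A_m + δ B_m)` — the block's "negative powers vanish" — and `P ⪰ 0` for small `η` by the
Gershgorin step of `Rows/DominantPencilPSD`. This file proves that chain ONCE, for tables a certificate supplies:

* data: `X j k` (the block's coefficients), `T0`, `T0inv`, exponents `a`, a non-forced mask `π` (forced kernel
  directions — e.g. `2Ŝ_z` in the `G`-block — carry `π = false`), the congruent tables `C j k`, a margin `μ`, factor
  certificates `(FA, DA)` of `A_0` and `(FB, DB)` of `A_0 + B_0 − μ·Π`, and row-sum bounds `ρ m`; the pencil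
  coefficients `A_m`, `B_m` are DERIVED from `C` and `a` (`pencilA`, `pencilB`: `A_m[i,i'] = Σ_j [2j = m + a_i + a_i'] C_{j0}[i,i']`);
* kernel-decidable hypotheses: `C j k = T0ᵀ · X j k · T0` and `T0inv · T0 = 1` as PAIR products (`pmul`), negative
  powers vanish (`a_i + a_i' > 2j ⇒ C_{jk}[i,i'] = 0`), `a_i ≤ 2`, symmetry and forced-row vanishing of `C`, the two
  factor identities with nonnegative pivots, and the rational row-sum bounds `Σ_i' (|p| + 3/2|q|)(A_m + B_m) ≤ ρ_m`;
* conclusion `realX_posSemidef`: for all real `δ ∈ (0, 1]` and `0 ≤ η ≤ 1` with `η · Σ_{m=1}^{4} ρ_m ≤ δ·μ`, the real matrix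
  `realX(η², δ)` is positive semidefinite. Proof: `L(δ) − δμΠ = (1−δ)A_0 + δ(A_0 + B_0 − μΠ) ⪰ 0` (factors);
  `posSemidef_of_dominant_mask` (the masked Gershgorin step); `Λ(η)·P·Λ(η) = Σ η^{2j} δ^k C_{jk} = T0ᵀ X(η², δ) T0`
  (`scale_pencil_eq`); `X = (Λ T0inv)ᵀ P (Λ T0inv)`.

0 `sorry`; eight `def`s (pair-matrix product / transpose / real cast, the derived pencil tables, the rational absolute
bound, the real block); no instance, no `def … : Prop`; standard axioms.
-/

set_option linter.style.longLine false

namespace Summit.Ventures.CertifiedQuantumChemistry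

namespace PencilBlock

open Matrix Finset SqrtTwo DominantPencil

/-! ## §1 Pair-matrix helpers -/

/-- Product of pair matrices (`ℚ(√2)` arithmetic). -/
def pmul {l m n : ℕ} (A : Fin l → Fin m → ℚ × ℚ) (B : Fin m → Fin n → ℚ × ℚ) : Fin l → Fin n → ℚ × ℚ :=
  fun i j => ∑ k, mul (A i k) (B k j)

/-- Transpose of a pair matrix. -/
def ptr {l m : ℕ} (A : Fin l → Fin m → ℚ × ℚ) : Fin m → Fin l → ℚ × ℚ := fun i j => A j i

/-- The real matrix of a pair matrix. -/
noncomputable def real {l m : ℕ} (A : Fin l → Fin m → ℚ × ℚ) : Matrix (Fin l) (Fin m) ℝ :=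
  Matrix.of fun i j => toReal (A i j)

/-- Rational upper bound of `|p + q√2|`. -/
def absq (x : ℚ × ℚ) : ℚ := |x.1| + 3 / 2 * |x.2|

/-- Entries of the real matrix of a pair matrix. -/
@[simp] theorem real_apply {l m : ℕ} (A : Fin l → Fin m → ℚ × ℚ) (i : Fin l) (j : Fin m) :
    real A i j = toReal (A i j) := rfl

/-- `real` is multiplicative on `pmul`. -/
theorem real_pmul {l m n : ℕ} (A : Fin l → Fin m → ℚ × ℚ) (B : Fin m → Fin n → ℚ × ℚ) :
    real (pmul A B) = real A * real B := by
  ext i j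
  simp only [real_apply, pmul, Matrix.mul_apply, toReal_sum, toReal_mul]

/-- `real` commutes with transposition. -/
theorem real_ptr {l m : ℕ} (A : Fin l → Fin m → ℚ × ℚ) : real (ptr A) = (real A)ᵀ := by
  ext i j; rfl

/-- The absolute value of an entry is at most the cast of `absq`. -/
theorem abs_toReal_le_absq (x : ℚ × ℚ) : |toReal x| ≤ (absq x : ℝ) := by
  have h := abs_toReal_le x
  simp only [absq, Rat.cast_add, Rat.cast_mul, Rat.cast_abs, Rat.cast_div, Rat.cast_ofNat]
  exact h

/-! ## §2 A masked Gershgorin step (forced kernel directions carry no margin) -/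

variable {d : ℕ}

/-- **Masked dominant part.** Let `π : Fin d → Bool` mark the live coordinates and `Pd = diagonal [π]`. If
`L − c·Pd ⪰ 0`, `E` is symmetric, its rows AND columns vanish at dead coordinates, and every absolute row sum of `E` is
`≤ c`, then `L + E ⪰ 0`. -/
theorem posSemidef_of_dominant_mask (L E : Matrix (Fin d) (Fin d) ℝ) (c : ℝ) (π : Fin d → Bool)
    (hL : (L - c • Matrix.diagonal (fun i => if π i then (1 : ℝ) else 0)).PosSemidef) (hE : E.IsSymm)
    (hdead : ∀ i j, π i = false → E i j = 0 ∧ E j i = 0) (hrow : ∀ i, ∑ j, |E i j| ≤ c) : (L + E).PosSemidef := by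
  set Pd : Matrix (Fin d) (Fin d) ℝ := Matrix.diagonal (fun i => if π i then (1 : ℝ) else 0) with hPd
  have hPdh : (c • Pd).IsHermitian := by
    rw [Matrix.IsHermitian, Matrix.conjTranspose_eq_transpose_of_trivial, Matrix.transpose_smul, hPd,
      Matrix.diagonal_transpose]
  have hLh : L.IsHermitian := by
    have h := hL.1.add hPdh
    rwa [sub_add_cancel] at h
  have hEh : E.IsHermitian := by
    rw [Matrix.IsHermitian, Matrix.conjTranspose_eq_transpose_of_trivial]; exact hE.eq
  refine Matrix.PosSemidef.of_dotProduct_mulVec_nonneg (hLh.add hEh) fun x => ?_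
  have hx : star x = x := by ext i; simp
  -- the masked vector
  set x' : Fin d → ℝ := fun i => if π i then x i else 0 with hx'
  have hEx : E *ᵥ x = E *ᵥ x' := by
    ext i; simp only [mulVec, dotProduct]
    refine Finset.sum_congr rfl fun j _ => ?_
    by_cases hj : π j
    · simp [hx', hj]
    · have := (hdead j i (by simpa using hj)).2; simp [hx', hj, this]
  have hxE : x ⬝ᵥ (E *ᵥ x') = x' ⬝ᵥ (E *ᵥ x') := by
    simp only [dotProduct]
    refine Finset.sum_congr rfl fun i _ => ?_
    by_cases hi : π i
    · simp [hx', hi]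
    · have h0 : (E *ᵥ x') i = 0 := by
        simp only [mulVec, dotProduct]
        exact Finset.sum_eq_zero fun j _ => by rw [(hdead i j (by simpa using hi)).1, zero_mul]
      rw [h0]; simp [hx', hi]
  rw [hx, Matrix.add_mulVec, dotProduct_add, hEx, hxE]
  have h1 : c * ∑ i, x' i ^ 2 ≤ x ⬝ᵥ (L *ᵥ x) := by
    have h := hL.dotProduct_mulVec_nonneg x
    rw [hx, Matrix.sub_mulVec, dotProduct_sub, Matrix.smul_mulVec, dotProduct_smul, smul_eq_mul] at h
    have e : x ⬝ᵥ (Pd *ᵥ x) = ∑ i, x' i ^ 2 := by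
      simp only [hPd, mulVec_diagonal, dotProduct, hx']
      refine Finset.sum_congr rfl fun i _ => ?_
      by_cases hi : π i <;> simp [hi, pow_two]
    rw [e] at h
    linarith
  have h2 := abs_quadForm_le_of_rowSum E hE c hrow x'
  have h3 : -(c * ∑ i, x' i ^ 2) ≤ x' ⬝ᵥ (E *ᵥ x') := by
    have := neg_abs_le (x' ⬝ᵥ (E *ᵥ x')); linarith
  linarith

/-! ## §3 The derived pencil of a block and its positivity -/

/-- Pencil coefficient `A_m[i,i'] = Σ_{j<3} [2j = m + a_i + a_i'] C_{j,0}[i,i']` (the `δ⁰` part). -/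
def pencilA (a : Fin d → ℕ) (C : Fin 3 → Fin 2 → Fin d → Fin d → ℚ × ℚ) (m : ℕ) : Fin d → Fin d → ℚ × ℚ :=
  fun i i' => ∑ j : Fin 3, if 2 * (j : ℕ) = m + a i + a i' then C j 0 i i' else 0

/-- Pencil coefficient `B_m[i,i'] = Σ_{j<3} [2j = m + a_i + a_i'] C_{j,1}[i,i']` (the `δ¹` part). -/
def pencilB (a : Fin d → ℕ) (C : Fin 3 → Fin 2 → Fin d → Fin d → ℚ × ℚ) (m : ℕ) : Fin d → Fin d → ℚ × ℚ :=
  fun i i' => ∑ j : Fin 3, if 2 * (j : ℕ) = m + a i + a i' then C j 1 i i' else 0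

/-- The real pencil `P(η, δ) = Σ_{m<5} η^m (A_m + δ B_m)`. -/
noncomputable def pencil (a : Fin d → ℕ) (C : Fin 3 → Fin 2 → Fin d → Fin d → ℚ × ℚ) (η δ : ℝ) :
    Matrix (Fin d) (Fin d) ℝ :=
  ∑ m ∈ Finset.range 5, η ^ m • (real (pencilA a C m) + δ • real (pencilB a C m))

/-- The real block `X(ε, δ) = Σ_{j<3, k<2} ε^j δ^k X_{jk}`. -/
noncomputable def realX (X : Fin 3 → Fin 2 → Fin d → Fin d → ℚ × ℚ) (ε δ : ℝ) : Matrix (Fin d) (Fin d) ℝ :=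
  ∑ j : Fin 3, ∑ k : Fin 2, (ε ^ (j : ℕ) * δ ^ (k : ℕ)) • real (X j k)

/-- **The pencil of a block is positive semidefinite for small `η`** (factor certificates for `A_0` and
`A_0 + B_0 − μΠ`, symmetry, dead rows, rational row-sum bounds). -/
theorem pencil_posSemidef (a : Fin d → ℕ) (C : Fin 3 → Fin 2 → Fin d → Fin d → ℚ × ℚ) (π : Fin d → Bool)
    (μ : ℚ) (ρ : ℕ → ℚ) {rA rB : ℕ} (FA : Fin d → Fin rA → ℚ × ℚ) (DA : Fin rA → ℚ × ℚ)
    (FB : Fin d → Fin rB → ℚ × ℚ) (DB : Fin rB → ℚ × ℚ)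
    (hfacA : ∀ i i', pencilA a C 0 i i' = ∑ k, mul (mul (FA i k) (DA k)) (FA i' k)) (hDA : ∀ k, nonneg (DA k) = true)
    (hfacB : ∀ i i', pencilA a C 0 i i' + pencilB a C 0 i i' - (if i = i' ∧ π i then ((μ, 0) : ℚ × ℚ) else 0) =
      ∑ k, mul (mul (FB i k) (DB k)) (FB i' k)) (hDB : ∀ k, nonneg (DB k) = true)
    (hsymm : ∀ j k i i', C j k i i' = C j k i' i)
    (hdead : ∀ j k i i', π i = false → C j k i i' = 0 ∧ C j k i' i = 0)
    (hρ : ∀ m, 1 ≤ m → m ≤ 4 → ∀ i, ∑ i', (absq (pencilA a C m i i') + absq (pencilB a C m i i')) ≤ ρ m)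
    {δ η : ℝ} (hδ0 : 0 ≤ δ) (hδ1 : δ ≤ 1) (hη0 : 0 ≤ η) (hη1 : η ≤ 1)
    (hηc : η * (((ρ 1 + ρ 2 + ρ 3 + ρ 4 : ℚ)) : ℝ) ≤ δ * (μ : ℝ)) :
    (pencil a C η δ).PosSemidef := by
  -- abbreviations
  set A : ℕ → Matrix (Fin d) (Fin d) ℝ := fun m => real (pencilA a C m) with hA
  set B : ℕ → Matrix (Fin d) (Fin d) ℝ := fun m => real (pencilB a C m) with hB
  set PdM : Matrix (Fin d) (Fin d) ℝ := Matrix.diagonal (fun i => if π i then (1 : ℝ) else 0) with hPdM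
  -- the order-0 margin: L(δ) − δμΠ = (1−δ) A0 + δ (A0 + B0 − μΠ)
  have hA0 : (A 0).PosSemidef := by
    have h := posSemidef_of_factor (pencilA a C 0) FA DA hfacA hDA
    simpa [hA, real] using h
  have hB0 : (A 0 + B 0 - (μ : ℝ) • PdM).PosSemidef := by
    have h := posSemidef_of_factor (fun i i' => pencilA a C 0 i i' + pencilB a C 0 i i' -
      (if i = i' ∧ π i then ((μ, 0) : ℚ × ℚ) else 0)) FB DB hfacB hDB
    have e : (Matrix.of fun i i' => toReal (pencilA a C 0 i i' + pencilB a C 0 i i' -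
        (if i = i' ∧ π i then ((μ, 0) : ℚ × ℚ) else 0))) = A 0 + B 0 - (μ : ℝ) • PdM := by
      ext i i'
      simp only [Matrix.of_apply, toReal_sub, toReal_add, hA, hB, real_apply, Matrix.add_apply, Matrix.sub_apply,
        Matrix.smul_apply, hPdM, Matrix.diagonal_apply, smul_eq_mul]
      by_cases h1 : i = i'
      · subst h1
        by_cases h2 : π i <;> simp [h2, toReal]
      · simp [h1, toReal]
    rwa [e] at h
  have hL : (A 0 + δ • B 0 - (δ * (μ : ℝ)) • PdM).PosSemidef := by
    have e : A 0 + δ • B 0 - (δ * (μ : ℝ)) • PdM = (1 - δ) • A 0 + δ • (A 0 + B 0 - (μ : ℝ) • PdM) := by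
      rw [smul_sub, smul_add, ← smul_smul]; module
    rw [e]
    exact (hA0.smul (by linarith)).add (hB0.smul hδ0)
  -- rewrite the pencil as L + E
  have hsplit : pencil a C η δ = (A 0 + δ • B 0) + ∑ m ∈ Finset.range 4, η ^ (m + 1) • (A (m + 1) + δ • B (m + 1)) := by
    rw [pencil, Finset.sum_range_succ', pow_zero, one_smul, add_comm]
  rw [hsplit]
  -- E: symmetric, dead rows vanish, row sums small
  have hCsym : ∀ m, (A m + δ • B m).IsSymm := fun m => by
    ext i i'
    simp only [Matrix.transpose_apply, Matrix.add_apply, Matrix.smul_apply, hA, hB, real_apply, pencilA, pencilB,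
      smul_eq_mul]
    have h0 : ∀ j : Fin 3, (if 2 * (j : ℕ) = m + a i' + a i then C j 0 i' i else 0) =
        (if 2 * (j : ℕ) = m + a i + a i' then C j 0 i i' else 0) := fun j => by
      rw [show m + a i' + a i = m + a i + a i' by ring]; split_ifs <;> [rw [hsymm]; rfl]
    have h1 : ∀ j : Fin 3, (if 2 * (j : ℕ) = m + a i' + a i then C j 1 i' i else 0) =
        (if 2 * (j : ℕ) = m + a i + a i' then C j 1 i i' else 0) := fun j => by
      rw [show m + a i' + a i = m + a i + a i' by ring]; split_ifs <;> [rw [hsymm]; rfl]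
    simp_rw [h0, h1]
  have hdeadAB : ∀ m i i', π i = false → (A m + δ • B m) i i' = 0 ∧ (A m + δ • B m) i' i = 0 := by
    intro m i i' hi
    have z : ∀ j k, C j k i i' = 0 ∧ C j k i' i = 0 := fun j k => hdead j k i i' hi
    constructor <;>
      simp only [Matrix.add_apply, Matrix.smul_apply, hA, hB, real_apply, pencilA, pencilB, smul_eq_mul] <;>
      simp [z, toReal_zero]
  refine posSemidef_of_dominant_mask _ _ (δ * (μ : ℝ)) π hL ?_ ?_ ?_
  · -- symmetry of E
    unfold Matrix.IsSymm
    rw [Matrix.transpose_sum]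
    refine Finset.sum_congr rfl fun m _ => ?_
    rw [Matrix.transpose_smul, (hCsym (m + 1)).eq]
  · -- dead rows of E
    intro i i' hi
    constructor <;> rw [Matrix.sum_apply] <;> refine Finset.sum_eq_zero fun m _ => ?_ <;>
      simp only [Matrix.smul_apply, smul_eq_mul]
    · rw [(hdeadAB (m + 1) i i' hi).1, mul_zero]
    · rw [(hdeadAB (m + 1) i i' hi).2, mul_zero]
  · -- row sums of E ≤ η Σρ ≤ δμ
    intro i
    have hrow := rowSum_eval_le (k := 4) (fun m => A (m + 1) + δ • B (m + 1)) (fun m => (ρ (m + 1) : ℝ))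
      (fun m hm i => ?_) hη0 i
    · refine hrow.trans ?_
      calc ∑ m ∈ Finset.range 4, η ^ (m + 1) * (ρ (m + 1) : ℝ)
          ≤ ∑ m ∈ Finset.range 4, η * (ρ (m + 1) : ℝ) := by
            refine Finset.sum_le_sum fun m hm => mul_le_mul_of_nonneg_right ?_ ?_
            · calc η ^ (m + 1) = η ^ m * η := pow_succ η m
                _ ≤ 1 * η := mul_le_mul_of_nonneg_right (pow_le_one₀ hη0 hη1) hη0
                _ = η := one_mul η
            · -- ρ ≥ 0 from the row-sum hypothesis at this m (sums of absq are ≥ 0)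
              have h := hρ (m + 1) (by omega) (by have := Finset.mem_range.1 hm; omega) i
              have h0 : (0 : ℚ) ≤ ∑ i', (absq (pencilA a C (m + 1) i i') + absq (pencilB a C (m + 1) i i')) :=
                Finset.sum_nonneg fun i' _ => by unfold absq; positivity
              exact_mod_cast h0.trans h
        _ = η * (((ρ 1 + ρ 2 + ρ 3 + ρ 4 : ℚ)) : ℝ) := by
            simp only [Finset.sum_range_succ, Finset.sum_range_zero, Rat.cast_add]; ring
        _ ≤ δ * (μ : ℝ) := hηc
    · -- per-coefficient row sums: |A + δB| ≤ absq A + absq B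
      have hm4 : m + 1 ≤ 4 := by omega
      have h := hρ (m + 1) (by omega) hm4 i
      have hcast : ((∑ i', (absq (pencilA a C (m + 1) i i') + absq (pencilB a C (m + 1) i i')) : ℚ) : ℝ) ≤
          (ρ (m + 1) : ℝ) := by exact_mod_cast h
      refine le_trans ?_ hcast
      rw [Rat.cast_sum]
      refine Finset.sum_le_sum fun i' _ => ?_
      simp only [Matrix.add_apply, Matrix.smul_apply, hA, hB, real_apply, smul_eq_mul, Rat.cast_add]
      calc |toReal (pencilA a C (m + 1) i i') + δ * toReal (pencilB a C (m + 1) i i')|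
          ≤ |toReal (pencilA a C (m + 1) i i')| + |δ * toReal (pencilB a C (m + 1) i i')| := abs_add_le _ _
        _ = |toReal (pencilA a C (m + 1) i i')| + δ * |toReal (pencilB a C (m + 1) i i')| := by
            rw [abs_mul, abs_of_nonneg hδ0]
        _ ≤ |toReal (pencilA a C (m + 1) i i')| + 1 * |toReal (pencilB a C (m + 1) i i')| := by
            gcongr
        _ ≤ (absq (pencilA a C (m + 1) i i') : ℝ) + (absq (pencilB a C (m + 1) i i') : ℝ) := by
            rw [one_mul]; exact add_le_add (abs_toReal_le_absq _) (abs_toReal_le_absq _)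

/-! ## §4 The scaling identity and the block theorem -/

/-- **Scaling identity.** If `C_{jk}[i,i'] = 0` whenever `a_i + a_i' > 2j` and `a_i ≤ 2`, then
`Λ(η) · P(η, δ) · Λ(η) = Σ_{j,k} η^{2j} δ^k C_{jk}` with `Λ(η) = diagonal(η^{a_i})`. -/
theorem scale_pencil_eq (a : Fin d → ℕ) (C : Fin 3 → Fin 2 → Fin d → Fin d → ℚ × ℚ)
    (hneg : ∀ (j : Fin 3) k i i', 2 * (j : ℕ) < a i + a i' → C j k i i' = 0) (ha : ∀ i, a i ≤ 2) (η δ : ℝ) :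
    Matrix.diagonal (fun i => η ^ a i) * pencil a C η δ * Matrix.diagonal (fun i => η ^ a i) =
      ∑ j : Fin 3, ∑ k : Fin 2, (η ^ (2 * (j : ℕ)) * δ ^ (k : ℕ)) • real (C j k) := by
  ext i i'
  rw [Matrix.mul_diagonal, Matrix.diagonal_mul]
  have hP : pencil a C η δ i i' =
      ∑ m ∈ Finset.range 5, η ^ m * (toReal (pencilA a C m i i') + δ * toReal (pencilB a C m i i')) := by
    simp only [pencil, Matrix.sum_apply, Matrix.smul_apply, Matrix.add_apply, real_apply, smul_eq_mul]
  rw [hP]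
  simp only [Matrix.sum_apply, Matrix.smul_apply, real_apply, smul_eq_mul]
  simp only [Fin.sum_univ_two, Fin.val_zero, Fin.val_one, pow_zero, pow_one, mul_one]
  -- abbreviations
  set s := a i + a i' with hs
  have hs4 : s ≤ 4 := by have := ha i; have := ha i'; omega
  -- each pencil coefficient entry as a sum over j of single terms
  have hA : ∀ m, toReal (pencilA a C m i i') = ∑ j : Fin 3, if 2 * (j : ℕ) = m + s then toReal (C j 0 i i') else 0 := by
    intro m; simp only [pencilA, toReal_sum, apply_ite toReal, toReal_zero]
    refine Finset.sum_congr rfl fun j _ => ?_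
    rw [hs, ← add_assoc]
  have hB : ∀ m, toReal (pencilB a C m i i') = ∑ j : Fin 3, if 2 * (j : ℕ) = m + s then toReal (C j 1 i i') else 0 := by
    intro m; simp only [pencilB, toReal_sum, apply_ite toReal, toReal_zero]
    refine Finset.sum_congr rfl fun j _ => ?_
    rw [hs, ← add_assoc]
  simp_rw [hA, hB]
  -- swap the sums: Σ_m η^m Σ_j [..] (c0 + δ c1) = Σ_j Σ_m [2j = m + s] η^m (c0 + δ c1)
  have step1 : η ^ a i * (∑ m ∈ Finset.range 5, η ^ m *
        ((∑ j : Fin 3, if 2 * (j : ℕ) = m + s then toReal (C j 0 i i') else 0) +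
          δ * ∑ j : Fin 3, if 2 * (j : ℕ) = m + s then toReal (C j 1 i i') else 0)) * η ^ a i' =
      ∑ j : Fin 3, ∑ m ∈ Finset.range 5,
        (if 2 * (j : ℕ) = m + s then η ^ (m + s) * (toReal (C j 0 i i') + δ * toReal (C j 1 i i')) else 0) := by
    rw [Finset.sum_comm]
    have e : η ^ a i * (∑ m ∈ Finset.range 5, η ^ m *
        ((∑ j : Fin 3, if 2 * (j : ℕ) = m + s then toReal (C j 0 i i') else 0) +
          δ * ∑ j : Fin 3, if 2 * (j : ℕ) = m + s then toReal (C j 1 i i') else 0)) * η ^ a i' =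
        ∑ m ∈ Finset.range 5, η ^ (m + s) *
          ((∑ j : Fin 3, if 2 * (j : ℕ) = m + s then toReal (C j 0 i i') else 0) +
            δ * ∑ j : Fin 3, if 2 * (j : ℕ) = m + s then toReal (C j 1 i i') else 0) := by
      rw [Finset.mul_sum, Finset.sum_mul]
      refine Finset.sum_congr rfl fun m _ => ?_
      rw [hs, pow_add, pow_add]; ring
    rw [e]
    refine Finset.sum_congr rfl fun m _ => ?_
    rw [mul_add, ← mul_assoc _ δ, Finset.mul_sum, Finset.mul_sum, ← Finset.sum_add_distrib]
    refine Finset.sum_congr rfl fun j _ => ?_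
    split_ifs <;> ring
  rw [step1]
  refine Finset.sum_congr rfl fun j _ => ?_
  -- inner sum over m collapses to the single value m = 2j − s (present iff s ≤ 2j)
  have hj : (j : ℕ) ≤ 2 := by have := j.isLt; omega
  rw [Finset.sum_eq_single (2 * (j : ℕ) - s)]
  · by_cases hle : s ≤ 2 * (j : ℕ)
    · have e1 : 2 * (j : ℕ) = 2 * (j : ℕ) - s + s := by omega
      rw [if_pos e1, show 2 * (j : ℕ) - s + s = 2 * (j : ℕ) by omega]
      ring
    · have e1 : ¬ 2 * (j : ℕ) = 2 * (j : ℕ) - s + s := by omega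
      rw [if_neg e1]
      have z0 : toReal (C j 0 i i') = 0 := by rw [hneg j 0 i i' (by omega)]; exact toReal_zero
      have z1 : toReal (C j 1 i i') = 0 := by rw [hneg j 1 i i' (by omega)]; exact toReal_zero
      rw [z0, z1]; ring
  · intro m _ hm
    rw [if_neg]; omega
  · intro h
    exfalso; exact h (Finset.mem_range.2 (by omega))

/-- **THE BLOCK THEOREM.** From the tables and the kernel-decidable hypotheses of a block certificate: for every
`δ ∈ (0, 1]`-margin (`0 ≤ δ ≤ 1`) and every `0 ≤ η ≤ 1` with `η · (ρ₁ + ρ₂ + ρ₃ + ρ₄) ≤ δμ`, the real block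
`X(η², δ)` is positive semidefinite. -/
theorem realX_posSemidef (X : Fin 3 → Fin 2 → Fin d → Fin d → ℚ × ℚ) (T0 T0inv : Fin d → Fin d → ℚ × ℚ)
    (a : Fin d → ℕ) (π : Fin d → Bool) (C : Fin 3 → Fin 2 → Fin d → Fin d → ℚ × ℚ) (μ : ℚ) (ρ : ℕ → ℚ)
    {rA rB : ℕ} (FA : Fin d → Fin rA → ℚ × ℚ) (DA : Fin rA → ℚ × ℚ) (FB : Fin d → Fin rB → ℚ × ℚ) (DB : Fin rB → ℚ × ℚ)
    (hC : ∀ j k, C j k = pmul (pmul (ptr T0) (X j k)) T0)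
    (hinv : pmul T0inv T0 = fun i j => if i = j then ((1, 0) : ℚ × ℚ) else 0)
    (hneg : ∀ (j : Fin 3) k i i', 2 * (j : ℕ) < a i + a i' → C j k i i' = 0) (ha : ∀ i, a i ≤ 2)
    (hfacA : ∀ i i', pencilA a C 0 i i' = ∑ k, mul (mul (FA i k) (DA k)) (FA i' k)) (hDA : ∀ k, nonneg (DA k) = true)
    (hfacB : ∀ i i', pencilA a C 0 i i' + pencilB a C 0 i i' - (if i = i' ∧ π i then ((μ, 0) : ℚ × ℚ) else 0) =
      ∑ k, mul (mul (FB i k) (DB k)) (FB i' k)) (hDB : ∀ k, nonneg (DB k) = true)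
    (hsymm : ∀ j k i i', C j k i i' = C j k i' i)
    (hdead : ∀ j k i i', π i = false → C j k i i' = 0 ∧ C j k i' i = 0)
    (hρ : ∀ m, 1 ≤ m → m ≤ 4 → ∀ i, ∑ i', (absq (pencilA a C m i i') + absq (pencilB a C m i i')) ≤ ρ m)
    {δ η : ℝ} (hδ0 : 0 ≤ δ) (hδ1 : δ ≤ 1) (hη0 : 0 ≤ η) (hη1 : η ≤ 1)
    (hηc : η * (((ρ 1 + ρ 2 + ρ 3 + ρ 4 : ℚ)) : ℝ) ≤ δ * (μ : ℝ)) :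
    (realX X (η ^ 2) δ).PosSemidef := by
  have hP := pencil_posSemidef a C π μ ρ FA DA FB DB hfacA hDA hfacB hDB hsymm hdead hρ hδ0 hδ1 hη0 hη1 hηc
  -- Λ P Λ ⪰ 0
  set Λ : Matrix (Fin d) (Fin d) ℝ := Matrix.diagonal (fun i => η ^ a i) with hΛ
  have hΛP : (Λ * pencil a C η δ * Λ).PosSemidef := by
    have h := hP.mul_mul_conjTranspose_same Λ
    have e : Λ.conjTranspose = Λ := by rw [hΛ, Matrix.diagonal_conjTranspose]; simp
    rwa [e] at h
  -- the congruent identity: T0ᵀ X(η²) T0 = Σ η^{2j} δ^k C_jk = Λ P Λ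
  have hTXT : (real T0)ᵀ * realX X (η ^ 2) δ * real T0 = Λ * pencil a C η δ * Λ := by
    rw [scale_pencil_eq a C hneg ha η δ, realX, Finset.mul_sum, Finset.sum_mul]
    refine Finset.sum_congr rfl fun j _ => ?_
    rw [Finset.mul_sum, Finset.sum_mul]
    refine Finset.sum_congr rfl fun k _ => ?_
    rw [Matrix.mul_smul, Matrix.smul_mul, hC j k, real_pmul, real_pmul, real_ptr, ← pow_mul]
  -- invertibility over ℝ
  have hinvR : real T0inv * real T0 = 1 := by
    rw [← real_pmul, hinv]
    ext i j
    simp only [real_apply, Matrix.one_apply]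
    split_ifs <;> simp [toReal]
  have hinvR' : real T0 * real T0inv = 1 := mul_eq_one_comm.mp hinvR
  -- X = T0invᵀ (T0ᵀ X T0) T0inv
  have hX : realX X (η ^ 2) δ = (Λ * real T0inv).conjTranspose * pencil a C η δ * (Λ * real T0inv) := by
    have e1 : realX X (η ^ 2) δ = (real T0inv)ᵀ * ((real T0)ᵀ * realX X (η ^ 2) δ * real T0) * real T0inv := by
      rw [← Matrix.mul_assoc, ← Matrix.mul_assoc, ← Matrix.transpose_mul, hinvR', Matrix.transpose_one,
        Matrix.one_mul, Matrix.mul_assoc, hinvR', Matrix.mul_one]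
    rw [e1, hTXT, Matrix.conjTranspose_eq_transpose_of_trivial, Matrix.transpose_mul, hΛ, Matrix.diagonal_transpose]
    simp only [Matrix.mul_assoc]
  rw [hX]
  exact hP.conjTranspose_mul_mul_same _

end PencilBlock

end Summit.Ventures.CertifiedQuantumChemistry
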